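import Literature.AlgebraicGeometry.Smoothening.OpenChart
import Literature.AlgebraicGeometry.Smoothening.DilatationDefect
import HarnessLib

/-!
# The centre of the next dilatation in the open chart (affine forest bookkeeping, BLR 3.4)

Topic: `Literature/AlgebraicGeometry/Smoothening` (Bosch–Lütkebohmert–Raynaud, *Néron Models*,
§3.4). In the chart `R[T₁, …, T_N, U]` of `X ∩ D(h)` (`OpenChart`) the centre of the next
dilatation is the ideal `𝔠 = (ϖ, g₁, …, g_r, hU - 1)` (`chartGens`; `centreIdealB ϖ (chartGens g h)`
in the notation of `DilatationDefect`). We prove: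

* `chartIdeal_eq` — the kernel of `R[T, U] → (B/J)_h̄` is `J R[T, U] + (hU - 1)` (the standard
  presentation of a localisation; `⊆` is `chartIdeal_le`);
* `centreIdealB_chartGens` — hence `𝔠 = chartIdeal (ϖ, g) h`, so `R[T, U]/𝔠 ≅ (B/(ϖ, g))_h̄` is a
  localisation (`OpenChart.isLocalization_away_chart`);
* `IsLocalization.Away.of_mul_le` — a localisation `(B/J₀)_h̄` is also the localisation away
  from `h̄` of `B/J` whenever `h J ⊆ J₀` and `h J₀ ⊆ J` (the two closed subschemes agree on
  `D(h)`);
* `isLocalization_away_centre` — consequently `R[T, U]/𝔠` is the localisation away from `h̄`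
  of `B/𝔶̃` for the ideal `𝔶̃` of the centre `Y` (`h 𝔶̃ ⊆ (ϖ, g)`, `h·(ϖ, g) ⊆ 𝔶̃`): the special
  fibre of the chart's centre *is* `Y ∩ D(h)`, which feeds the density lemma
  `SpecializationIdeal.eq_zero_of_forall_residue_eq_zero_away`.

[folklore]; no named facts (D-0026).

## References

* S. Bosch, W. Lütkebohmert, M. Raynaud, *Néron Models*, Springer 1990, §3.4 (proof of Thm. 2).
  [BLRNeronModels1990] (Not held; number only.)
-/

noncomputable section

open MvPolynomial

namespace Literature.AlgebraicGeometry.Smoothening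

universe u

/-! ### The kernel of the chart map, explicitly -/

section Kernel

variable {R : Type u} [CommRing R] {N : ℕ} (J : Ideal (MvPolynomial (Fin N) R))
  (h : MvPolynomial (Fin N) R)

/-- `rename` of `J` dies in the chart. [folklore] -/
theorem rename_mem_chartIdeal {x : MvPolynomial (Fin N) R} (hx : x ∈ J) :
    rename Fin.castSucc x ∈ chartIdeal J h := by
  rw [chartIdeal, RingHom.mem_ker]
  change chartMap J h (rename Fin.castSucc x) = 0
  rw [chartMap_rename, Ideal.Quotient.eq_zero_iff_mem.mpr hx, map_zero]

/-- `hU - 1` dies in the chart. [folklore] -/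
theorem rel_mem_chartIdeal : rename Fin.castSucc h * X (Fin.last N) - 1 ∈ chartIdeal J h :=
  chartMap_rel J h

/-- **The ideal of the chart, explicitly**: `chartIdeal J h = J·R[T, U] + (hU - 1)`. [folklore] -/
theorem chartIdeal_eq :
    chartIdeal J h = J.map (rename Fin.castSucc : MvPolynomial (Fin N) R →ₐ[R] _) ⊔
      Ideal.span {rename Fin.castSucc h * X (Fin.last N) - 1} := by
  apply le_antisymm
  · refine chartIdeal_le J h _ (Ideal.mem_sup_right (Ideal.subset_span rfl)) fun x hx => ?_
    rw [map_mul]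
    exact Ideal.mem_sup_left (Ideal.mul_mem_left _ _ (Ideal.mem_map_of_mem _ hx))
  · refine sup_le ?_ ?_
    · rw [Ideal.map_le_iff_le_comap]
      intro x hx
      exact rename_mem_chartIdeal J h hx
    · rw [Ideal.span_singleton_le_iff_mem]
      exact rel_mem_chartIdeal J h

/-- `h` is a unit modulo any ideal containing `hU - 1`. [folklore] -/
theorem isUnit_mk_rename_of_rel_mem (𝔠 : Ideal (MvPolynomial (Fin (N + 1)) R))
    (hU : rename Fin.castSucc h * X (Fin.last N) - 1 ∈ 𝔠) :
    IsUnit (Ideal.Quotient.mk 𝔠 (rename Fin.castSucc h)) := by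
  refine IsUnit.of_mul_eq_one (Ideal.Quotient.mk 𝔠 (X (Fin.last N))) ?_
  rw [← map_mul, ← sub_eq_zero, ← map_one (Ideal.Quotient.mk 𝔠), ← map_sub]
  exact Ideal.Quotient.eq_zero_iff_mem.mpr hU

/-- If `rename (h x)` lies in an ideal containing `hU - 1`, so does `rename x` (`h` is a unit
modulo such an ideal). [folklore] -/
theorem rename_mem_of_rename_mul_mem (𝔠 : Ideal (MvPolynomial (Fin (N + 1)) R))
    (hU : rename Fin.castSucc h * X (Fin.last N) - 1 ∈ 𝔠) {x : MvPolynomial (Fin N) R}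
    (hx : rename Fin.castSucc (h * x) ∈ 𝔠) : rename Fin.castSucc x ∈ 𝔠 := by
  have hunit := isUnit_mk_rename_of_rel_mem h 𝔠 hU
  rw [← Ideal.Quotient.eq_zero_iff_mem] at hx ⊢
  rw [map_mul, map_mul] at hx
  exact (hunit.mul_right_eq_zero).mp hx

end Kernel

/-! ### The generators of the centre in the chart -/

section Gens

variable {R : Type u} [CommRing R] {N r : ℕ} (g : Fin r → MvPolynomial (Fin N) R)
  (a : Fin r → Fin N) (h : MvPolynomial (Fin N) R)

/-- The generators of the centre in the chart `R[T, U]`: `g₁, …, g_r` and `hU - 1`. [folklore] -/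
def chartGens : Fin (r + 1) → MvPolynomial (Fin (N + 1)) R :=
  Fin.lastCases (rename Fin.castSucc h * X (Fin.last N) - 1) fun j => rename Fin.castSucc (g j)

/-- The columns of the minor in the chart: the old columns `a` and the new variable `U`.
[folklore] -/
def chartCols : Fin (r + 1) → Fin (N + 1) :=
  Fin.lastCases (Fin.last N) fun j => Fin.castSucc (a j)

/-- The last generator is `hU - 1`. [folklore] -/
@[simp] theorem chartGens_last : chartGens g h (Fin.last r) = rename Fin.castSucc h * X (Fin.last N) - 1 :=
  Fin.lastCases_last

/-- The first generators are the `g_j`. [folklore] -/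
@[simp] theorem chartGens_castSucc (j : Fin r) :
    chartGens g h (Fin.castSucc j) = rename Fin.castSucc (g j) :=
  Fin.lastCases_castSucc _

/-- The last column is `U`. [folklore] -/
@[simp] theorem chartCols_last : chartCols a (Fin.last r) = Fin.last N := Fin.lastCases_last

/-- The first columns are the `a j`. [folklore] -/
@[simp] theorem chartCols_castSucc (j : Fin r) : chartCols a (Fin.castSucc j) = Fin.castSucc (a j) :=
  Fin.lastCases_castSucc _

/-- The chart columns are injective when `a` is. [folklore] -/
theorem chartCols_injective (ha : Function.Injective a) : Function.Injective (chartCols a) := by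
  intro i j hij
  induction i using Fin.lastCases with
  | last =>
    induction j using Fin.lastCases with
    | last => rfl
    | cast j =>
      rw [chartCols_last, chartCols_castSucc] at hij
      exact absurd hij.symm (Fin.castSucc_lt_last (a j)).ne
  | cast i =>
    induction j using Fin.lastCases with
    | last =>
      rw [chartCols_last, chartCols_castSucc] at hij
      exact absurd hij (Fin.castSucc_lt_last (a i)).ne
    | cast j =>
      rw [chartCols_castSucc, chartCols_castSucc] at hij
      rw [ha (Fin.castSucc_injective _ hij)]

/-- A polynomial in `T` alone has no `U`-derivative. [folklore] -/
theorem pderiv_last_rename (p : MvPolynomial (Fin N) R) :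
    pderiv (Fin.last N) (rename Fin.castSucc p) = 0 := by
  induction p using MvPolynomial.induction_on with
  | C c => simp
  | add p q hp hq => simp [hp, hq]
  | mul_X p i hp =>
    rw [map_mul, rename_X, Derivation.leibniz, hp, smul_zero, add_zero,
      pderiv_X_of_ne (Fin.castSucc_lt_last i).ne, smul_zero]

variable (ϖ : R)

/-- **The centre of the chart is the chart of the centre**:
`(ϖ, g, hU - 1) = chartIdeal (ϖ, g) h` in `R[T, U]`. [folklore] -/
theorem centreIdealB_chartGens :
    centreIdealB ϖ (chartGens g h) = chartIdeal (centreIdealB ϖ g) h := by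
  rw [chartIdeal_eq, centreIdealB, centreIdealB, Ideal.map_span, Set.image_insert_eq]
  apply le_antisymm
  · rw [Ideal.span_le]
    rintro x (rfl | ⟨j, rfl⟩)
    · refine Ideal.mem_sup_left (Ideal.subset_span (Or.inl ?_))
      simp [MvPolynomial.algebraMap_eq]
    · induction j using Fin.lastCases with
      | last =>
        rw [chartGens_last]
        exact Ideal.mem_sup_right (Ideal.subset_span rfl)
      | cast j =>
        rw [chartGens_castSucc]
        exact Ideal.mem_sup_left (Ideal.subset_span (Or.inr ⟨_, ⟨j, rfl⟩, rfl⟩))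
  · refine sup_le ?_ ?_
    · rw [Ideal.span_le]
      rintro x (rfl | ⟨_, ⟨j, rfl⟩, rfl⟩)
      · refine Ideal.subset_span (Or.inl ?_)
        simp [MvPolynomial.algebraMap_eq]
      · exact Ideal.subset_span (Or.inr ⟨Fin.castSucc j, chartGens_castSucc g h j⟩)
    · rw [Ideal.span_singleton_le_iff_mem]
      exact Ideal.subset_span (Or.inr ⟨Fin.last r, chartGens_last g h⟩)

end Gens

/-! ### A localisation seen from a neighbouring closed subscheme -/

section Away

variable {B : Type u} [CommRing B] (J₀ J : Ideal B) (h : B) (T : Type u) [CommRing T]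
  [Algebra (B ⧸ J₀) T] [IsLocalization.Away (Ideal.Quotient.mk J₀ h) T]

/-- If `h J ⊆ J₀` then `J` dies in `(B/J₀)_h̄`. [folklore] -/
theorem algebraMap_quotient_eq_zero_of_mul_mem (hJ : ∀ x ∈ J, h * x ∈ J₀) {x : B} (hx : x ∈ J) :
    algebraMap (B ⧸ J₀) T (Ideal.Quotient.mk J₀ x) = 0 := by
  have hu : IsUnit (algebraMap (B ⧸ J₀) T (Ideal.Quotient.mk J₀ h)) :=
    IsLocalization.Away.algebraMap_isUnit _
  rw [← hu.mul_right_eq_zero, ← map_mul, ← map_mul, Ideal.Quotient.eq_zero_iff_mem.mpr (hJ x hx),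
    map_zero]

/-- The `B/J`-algebra structure on `(B/J₀)_h̄` when `h J ⊆ J₀`. [folklore] -/
abbrev algebraOfMulLe (hJ : ∀ x ∈ J, h * x ∈ J₀) : Algebra (B ⧸ J) T :=
  (Ideal.Quotient.lift J ((algebraMap (B ⧸ J₀) T).comp (Ideal.Quotient.mk J₀)) fun _ hx =>
    algebraMap_quotient_eq_zero_of_mul_mem J₀ J h T hJ hx).toAlgebra

/-- **A localisation seen from a neighbouring closed subscheme**: if `h J ⊆ J₀` and `h J₀ ⊆ J`
(the closed subschemes `V(J)` and `V(J₀)` agree on `D(h)`), then `(B/J₀)_h̄` is the localisation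
of `B/J` away from `h̄`. [folklore] -/
theorem IsLocalization.Away.of_mul_le (hJ : ∀ x ∈ J, h * x ∈ J₀) (hJ₀ : ∀ x ∈ J₀, h * x ∈ J) :
    letI := algebraOfMulLe J₀ J h T hJ
    IsLocalization.Away (Ideal.Quotient.mk J h) T := by
  letI := algebraOfMulLe J₀ J h T hJ
  have hmap : ∀ x : B, algebraMap (B ⧸ J) T (Ideal.Quotient.mk J x) =
      algebraMap (B ⧸ J₀) T (Ideal.Quotient.mk J₀ x) := fun x => rfl
  refine ⟨?_, ?_, ?_⟩
  · rintro ⟨_, n, rfl⟩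
    rw [map_pow, hmap]
    exact (IsLocalization.Away.algebraMap_isUnit (Ideal.Quotient.mk J₀ h)).pow n
  · intro z
    obtain ⟨n, y, hy⟩ := IsLocalization.Away.surj (Ideal.Quotient.mk J₀ h) z
    obtain ⟨y, rfl⟩ := Ideal.Quotient.mk_surjective y
    refine ⟨⟨Ideal.Quotient.mk J y, ⟨_, n, rfl⟩⟩, ?_⟩
    simp only [map_pow, hmap]
    rw [← map_pow, ← hy, map_pow]
  · intro y₁ y₂ hy
    obtain ⟨b₁, rfl⟩ := Ideal.Quotient.mk_surjective y₁
    obtain ⟨b₂, rfl⟩ := Ideal.Quotient.mk_surjective y₂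
    rw [hmap, hmap] at hy
    obtain ⟨⟨_, n, rfl⟩, hn⟩ := (IsLocalization.eq_iff_exists (Submonoid.powers (Ideal.Quotient.mk J₀ h)) T).mp hy
    simp only [← map_pow, ← map_mul] at hn
    have hn' : h ^ n * b₁ - h ^ n * b₂ ∈ J₀ := (Ideal.Quotient.eq).mp hn
    refine ⟨⟨_, n + 1, rfl⟩, ?_⟩
    simp only [← map_pow, ← map_mul]
    refine (Ideal.Quotient.eq).mpr ?_
    rw [pow_succ', mul_assoc, mul_assoc, ← mul_sub]
    exact hJ₀ _ hn'

end Away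

/-! ### The special fibre of the chart's centre is `Y ∩ D(h)` -/

section Centre

variable {R : Type u} [CommRing R] (ϖ : R) {N r : ℕ} (g : Fin r → MvPolynomial (Fin N) R)
  (h : MvPolynomial (Fin N) R) (𝔶 : Ideal (MvPolynomial (Fin N) R))

/-- `(ϖ, g)·R[T, U] ⊆ (ϖ, g, hU - 1)`. [folklore] -/
theorem map_centreIdealB_le :
    (centreIdealB ϖ g).map (rename Fin.castSucc : MvPolynomial (Fin N) R →ₐ[R] _) ≤
      centreIdealB ϖ (chartGens g h) := by
  rw [centreIdealB, Ideal.map_span, Ideal.span_le, Set.image_insert_eq]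
  rintro x (rfl | ⟨_, ⟨j, rfl⟩, rfl⟩)
  · refine Ideal.subset_span (Set.mem_insert_iff.mpr (Or.inl ?_))
    simp [MvPolynomial.algebraMap_eq]
  · exact Ideal.subset_span (Set.mem_insert_of_mem _ ⟨Fin.castSucc j, chartGens_castSucc g h j⟩)

/-- `hU - 1 ∈ (ϖ, g, hU - 1)`. [folklore] -/
theorem rel_mem_centreIdealB :
    rename Fin.castSucc h * X (Fin.last N) - 1 ∈ centreIdealB ϖ (chartGens g h) :=
  Ideal.subset_span (Set.mem_insert_of_mem _ ⟨Fin.last r, chartGens_last g h⟩)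

/-- `h` is a unit modulo `(ϖ, g, hU - 1)`. [folklore] -/
theorem isUnit_mk_centreIdealB_rename :
    IsUnit (Ideal.Quotient.mk (centreIdealB ϖ (chartGens g h)) (rename Fin.castSucc h)) :=
  isUnit_mk_rename_of_rel_mem h _ (rel_mem_centreIdealB ϖ g h)

/-- If `h 𝔶̃ ⊆ (ϖ, g)` then `𝔶̃` dies in `R[T, U]/(ϖ, g, hU - 1)`. [folklore] -/
theorem rename_mem_centreIdealB (h𝔶 : ∀ y ∈ 𝔶, h * y ∈ centreIdealB ϖ g) {y : MvPolynomial (Fin N) R}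
    (hy : y ∈ 𝔶) : rename Fin.castSucc y ∈ centreIdealB ϖ (chartGens g h) :=
  rename_mem_of_rename_mul_mem h _ (rel_mem_centreIdealB ϖ g h)
    (map_centreIdealB_le ϖ g h (Ideal.mem_map_of_mem _ (h𝔶 y hy)))

/-- The `B/𝔶̃`-algebra structure on `R[T, U]/(ϖ, g, hU - 1)` when `h 𝔶̃ ⊆ (ϖ, g)`:
`y ↦ rename y`. [folklore] -/
abbrev algebraCentre (h𝔶 : ∀ y ∈ 𝔶, h * y ∈ centreIdealB ϖ g) :
    Algebra (MvPolynomial (Fin N) R ⧸ 𝔶)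
      (MvPolynomial (Fin (N + 1)) R ⧸ centreIdealB ϖ (chartGens g h)) :=
  (Ideal.Quotient.lift 𝔶 ((Ideal.Quotient.mk (centreIdealB ϖ (chartGens g h))).comp
      (rename Fin.castSucc : MvPolynomial (Fin N) R →ₐ[R] MvPolynomial (Fin (N + 1)) R).toRingHom)
    fun _ hy => Ideal.Quotient.eq_zero_iff_mem.mpr (rename_mem_centreIdealB ϖ g h 𝔶 h𝔶 hy)).toAlgebra

/-- The structure map on classes. [folklore] -/
theorem algebraMap_centre_mk (h𝔶 : ∀ y ∈ 𝔶, h * y ∈ centreIdealB ϖ g) (b : MvPolynomial (Fin N) R) :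
    letI := algebraCentre ϖ g h 𝔶 h𝔶
    algebraMap (MvPolynomial (Fin N) R ⧸ 𝔶) (MvPolynomial (Fin (N + 1)) R ⧸ centreIdealB ϖ (chartGens g h))
      (Ideal.Quotient.mk 𝔶 b) = Ideal.Quotient.mk _ (rename Fin.castSucc b) := rfl

/-- **The special fibre of the chart's centre is `Y ∩ D(h)`**: if `h 𝔶̃ ⊆ (ϖ, g)` and
`h·(ϖ, g) ⊆ 𝔶̃`, then `R[T, U]/(ϖ, g, hU - 1)` is the localisation of `B/𝔶̃` away from `h̄`.
[folklore] -/
theorem isLocalization_away_centre (h𝔶 : ∀ y ∈ 𝔶, h * y ∈ centreIdealB ϖ g)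
    (hg : ∀ x ∈ centreIdealB ϖ g, h * x ∈ 𝔶) :
    letI := algebraCentre ϖ g h 𝔶 h𝔶
    IsLocalization.Away (Ideal.Quotient.mk 𝔶 h)
      (MvPolynomial (Fin (N + 1)) R ⧸ centreIdealB ϖ (chartGens g h)) := by
  letI := algebraCentre ϖ g h 𝔶 h𝔶
  letI := algebraOfMulLe (centreIdealB ϖ g) 𝔶 h
    (MvPolynomial (Fin (N + 1)) R ⧸ chartIdeal (centreIdealB ϖ g) h) h𝔶
  haveI : IsLocalization.Away (Ideal.Quotient.mk 𝔶 h)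
      (MvPolynomial (Fin (N + 1)) R ⧸ chartIdeal (centreIdealB ϖ g) h) :=
    IsLocalization.Away.of_mul_le (centreIdealB ϖ g) 𝔶 h _ h𝔶 hg
  let e : (MvPolynomial (Fin (N + 1)) R ⧸ chartIdeal (centreIdealB ϖ g) h) ≃ₐ[MvPolynomial (Fin N) R ⧸ 𝔶]
      (MvPolynomial (Fin (N + 1)) R ⧸ centreIdealB ϖ (chartGens g h)) :=
    AlgEquiv.ofRingEquiv (f := Ideal.quotEquivOfEq (centreIdealB_chartGens g h ϖ).symm) fun y => by
      obtain ⟨b, rfl⟩ := Ideal.Quotient.mk_surjective y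
      change Ideal.quotEquivOfEq _ (algebraMap (MvPolynomial (Fin N) R ⧸ centreIdealB ϖ g)
        (MvPolynomial (Fin (N + 1)) R ⧸ chartIdeal (centreIdealB ϖ g) h)
          (Ideal.Quotient.mk (centreIdealB ϖ g) b)) = _
      rw [algebraMap_chart_mk, Ideal.quotEquivOfEq_mk]
      rfl
  exact IsLocalization.isLocalization_of_algEquiv _ e

end Centre

end Literature.AlgebraicGeometry.Smoothening

end
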